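import Summits.RiemannHypothesis.RiemannHypothesis.Theorems.Splittings.JensenWindowCensusSign

/-!
# Jensen-window census II (part 2/4) — the census identity (Kim 1996 (2.4)) and the Rolle dichotomy

Cell rh-split, seat rh-split-jen-neg g7 (scratch `SketchG7.lean` 02ca2ea96404222a; staged monolith 1f49da2f12defbf0, farm
rc 0 / 0 sorries, standard axioms; referee g5 REPLAY PASS ×2 + BYTES PASS), cut per rh-split-lead RULING #63/#63b (OPTION A:
all four parts under Theorems/Splittings/, parts 1–3 def-carrying = definition lane, part 4 = the item proof).  Decl bodies
verbatim (renames vs the monolith: `zeroCount ↦ zeroCountC`, `exists_ball_ne_zero ↦ exists_ball_ne_zero_of_entire`; the helper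
`analyticOrderAt_ne_top_of_entire` became private copies `…_aux`).  Zero `sorry`, no instances, no notation.
HONEST LABEL: «SPLITTING SEARCH over kernel-typed RH-EQUIVALENCES; a splitting A ∧ B ⟹ RH is CONDITIONAL
bookkeeping unless A and B are both proved; nothing here bears on the truth of RH.»

IN PRINT: the census identity, the real-axis Rolle/Pólya equation and the local critical-point count
are Y.-O. Kim, Proc. AMS 124 (1996) 819–830 [Kim1996], Theorem 1 p. 821 and its proof — (2.3) `Im z · Im f'/f < 0` off the
Jensen set, (2.4) `(1/2π) Δ_Γ arg f'/f = ½(sgn f'(a)/f(a) − sgn f'(b)/f(b))`, and Pólya's 1930 equation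
`2K = N' − N − ½(sgn f'(a)/f(a) − sgn f'(b)/f(b))` (Quart. J. Math. Oxford 1, pp. 29–30), pp. 822–823 — stated there for `f` of
genus `1*` on a strip `a ≤ Re z ≤ b` with `a, b` outside the Jensen set.  Here: an ARBITRARY real entire `f`, a bounded window
`[α,β] × [−h,h]`, the pointwise boundary-sign hypothesis `Im w · Im (f'/f)(w) < 0` on the non-real boundary (which (2.3)
supplies in Kim's setting), multiplicities, and the exact rectangle argument principle of
`Literature.Analysis.Complex.ArgumentPrincipleRectangle` — a formalisation and mild generalisation, not a new theorem.
Further sources: Ki–Kim, Duke Math. J. 104 (2000) §3 (3.1) p. 54, Thm 4.1 p. 60 [KiKim2000] (`KiKim.fourK`);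
Craven–Csordas–Smith, Ann. of Math. 125 (1987) (Jensen discs).

`census_core`: for a real entire `f` and `K = [α,β] × [−h,h]` with `f·f' ≠ 0` at `α, β` and `Im w · Im (f'/f)(w) < 0`
at the non-real points of `∂K`, `2·(N_{f'}(K°) − N_f(K°)) = sgn Re (f'/f)(α) − sgn Re (f'/f)(β)` (multiplicities; exact
edge logarithms in the slit plane + `integral_boundary_rect_logDeriv`); `census` (Jensen-window case).  `RolleIdentity`,
`LocalA` (zeros of `f'` in `K°` are real), `LocalB` (strict Laguerre inequality at the critical points of `Re f|ℝ` off its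
zeros) and `no_nonreal_zero_of_rolle(_core)`: local A + the real-axis Rolle identity exclude non-real zeros of `f` from `K°`.
-/

noncomputable section

open Complex Filter Metric Set Topology
open scoped ComplexConjugate

set_option linter.dupNamespace false

namespace Summit.RiemannHypothesis.RiemannHypothesis.Theorems.Splittings.JensenWindow

open Literature.Analysis.Complex

variable {f g : ℂ → ℂ}

/-- Module-local twin of part 1's private helper (public statement in the tree: `UniversalFactor.im_logDeriv_ofReal`). -/
private theorem logDeriv_ofReal_im' (hfd : Differentiable ℂ f) (hreal : ∀ x : ℝ, (f x).im = 0)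
    (x : ℝ) : (deriv f x / f x).im = 0 := by
  rw [Complex.div_im, hreal x, im_deriv_ofReal hfd hreal x]
  ring

/-- (Core form over a sign predicate.) **The Jensen-window census.**  For a real entire `f` of order `< 2` with a zero, and a Jensen
window `[α,β] × [−h,h]`:
`2 (N_{f'}(K°) − N_f(K°)) = sgn (f'/f)(α) − sgn (f'/f)(β)`. (boundary-sign window form) [cite: Kim1996, (2.4) pp. 822–823] -/
theorem census_core (hfd : Differentiable ℂ f) (hreal : ∀ x : ℝ, (f x).im = 0) {P : ℂ → Prop}
    (hsgn : ∀ {w : ℂ}, w.im ≠ 0 → P w → w.im * (deriv f w / f w).im < 0)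
    {α β h : ℝ} (hW : SWindow f P α β h) :
    2 * (zeroCountC (deriv f) (Ioo α β ×ℂ Ioo (-h) h) - zeroCountC f (Ioo α β ×ℂ Ioo (-h) h)) =
      sgn (deriv f α / f α).re - sgn (deriv f β / f β).re := by
  have hhl : -h < h := by linarith [hW.pos]
  have bot := hW.bot
  -- signs / non-vanishing on the edges (from the sign predicate)
  have sgn_pt : ∀ {w : ℂ}, w.im ≠ 0 → P w → w.im * (deriv f w / f w).im < 0 :=
    fun hw hc ↦ hsgn hw hc
  have fnz : ∀ {w : ℂ}, w.im ≠ 0 → P w → f w ≠ 0 := by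
    intro w hw hc h0
    have h1 := hsgn hw hc
    rw [h0, div_zero, Complex.zero_im, mul_zero] at h1
    exact lt_irrefl _ h1
  have dnz : ∀ {w : ℂ}, w.im ≠ 0 → P w → deriv f w ≠ 0 := by
    intro w hw hc h0
    have h1 := hsgn hw hc
    rw [h0, zero_div, Complex.zero_im, mul_zero] at h1
    exact lt_irrefl _ h1
  have imT : ∀ x : ℝ, ((x : ℂ) + (h : ℂ) * I).im = h := by intro x; simp
  have imB : ∀ x : ℝ, ((x : ℂ) + ((-h : ℝ) : ℂ) * I).im = -h := by intro x; simp
  have imS : ∀ a y : ℝ, ((a : ℂ) + (y : ℂ) * I).im = y := by intro a y; simp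
  have hne : h ≠ 0 := hW.pos.ne'
  have fT : ∀ x ∈ Icc α β, f ((x : ℂ) + (h : ℂ) * I) ≠ 0 :=
    fun x hx ↦ fnz (by rw [imT]; exact hne) (hW.top x hx)
  have fB : ∀ x ∈ Icc α β, f ((x : ℂ) + ((-h : ℝ) : ℂ) * I) ≠ 0 :=
    fun x hx ↦ fnz (by rw [imB]; exact neg_ne_zero.2 hne) (bot x hx)
  have dT : ∀ x ∈ Icc α β, deriv f ((x : ℂ) + (h : ℂ) * I) ≠ 0 :=
    fun x hx ↦ dnz (by rw [imT]; exact hne) (hW.top x hx)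
  have dB : ∀ x ∈ Icc α β, deriv f ((x : ℂ) + ((-h : ℝ) : ℂ) * I) ≠ 0 :=
    fun x hx ↦ dnz (by rw [imB]; exact neg_ne_zero.2 hne) (bot x hx)
  have fS : ∀ {a : ℝ}, f a ≠ 0 → (∀ y ∈ Icc (-h) h, y ≠ 0 → P ((a : ℂ) + (y : ℂ) * I)) →
      ∀ y ∈ Icc (-h) h, f ((a : ℂ) + (y : ℂ) * I) ≠ 0 := by
    intro a ha hcl y hy
    by_cases hy0 : y = 0
    · subst hy0; simpa using ha
    · exact fnz (by rw [imS]; exact hy0) (hcl y hy hy0)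
  have dS : ∀ {a : ℝ}, deriv f a ≠ 0 →
      (∀ y ∈ Icc (-h) h, y ≠ 0 → P ((a : ℂ) + (y : ℂ) * I)) →
      ∀ y ∈ Icc (-h) h, deriv f ((a : ℂ) + (y : ℂ) * I) ≠ 0 := by
    intro a ha hcl y hy
    by_cases hy0 : y = 0
    · subst hy0; simpa using ha
    · exact dnz (by rw [imS]; exact hy0) (hcl y hy hy0)
  have fL := fS hW.fα hW.left
  have fR := fS hW.fβ hW.right
  have dL := dS hW.dα hW.left
  have dR := dS hW.dβ hW.right
  -- slit-plane membership of `gU` on the upper half and `gL` on the lower half of `∂K`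
  have sT : ∀ x ∈ Icc α β, gU f ((x : ℂ) + (h : ℂ) * I) ∈ slitPlane := by
    intro x hx
    apply gU_mem_slitPlane_of_im_neg
    have h1 := sgn_pt (by rw [imT]; exact hne) (hW.top x hx)
    rw [imT] at h1
    nlinarith [hW.pos]
  have sB : ∀ x ∈ Icc α β, gL f ((x : ℂ) + ((-h : ℝ) : ℂ) * I) ∈ slitPlane := by
    intro x hx
    apply gL_mem_slitPlane_of_im_pos
    have h1 := sgn_pt (by rw [imB]; exact neg_ne_zero.2 hne) (bot x hx)
    rw [imB] at h1
    nlinarith [hW.pos]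
  have sU : ∀ {a : ℝ}, f a ≠ 0 → deriv f a ≠ 0 →
      (∀ y ∈ Icc (-h) h, y ≠ 0 → P ((a : ℂ) + (y : ℂ) * I)) →
      ∀ y ∈ Icc (0 : ℝ) h, gU f ((a : ℂ) + (y : ℂ) * I) ∈ slitPlane := by
    intro a ha hda hcl y hy
    by_cases hy0 : y = 0
    · subst hy0
      have e : ((a : ℂ) + ((0 : ℝ) : ℂ) * I) = (a : ℂ) := by simp
      rw [e]
      exact gU_mem_slitPlane_of_real (logDeriv_ofReal_im' hfd hreal a) (div_ne_zero hda ha)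
    · have hy' : y ∈ Icc (-h) h := ⟨by linarith [hy.1, hW.pos], hy.2⟩
      apply gU_mem_slitPlane_of_im_neg
      have h1 := sgn_pt (by rw [imS]; exact hy0) (hcl y hy' hy0)
      rw [imS] at h1
      have hy1 : 0 < y := lt_of_le_of_ne hy.1 (Ne.symm hy0)
      nlinarith
  have sLo : ∀ {a : ℝ}, f a ≠ 0 → deriv f a ≠ 0 →
      (∀ y ∈ Icc (-h) h, y ≠ 0 → P ((a : ℂ) + (y : ℂ) * I)) →
      ∀ y ∈ Icc (-h) (0 : ℝ), gL f ((a : ℂ) + (y : ℂ) * I) ∈ slitPlane := by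
    intro a ha hda hcl y hy
    by_cases hy0 : y = 0
    · subst hy0
      have e : ((a : ℂ) + ((0 : ℝ) : ℂ) * I) = (a : ℂ) := by simp
      rw [e]
      exact gL_mem_slitPlane_of_real (logDeriv_ofReal_im' hfd hreal a) (div_ne_zero hda ha)
    · have hy' : y ∈ Icc (-h) h := ⟨hy.1, by linarith [hy.2, hW.pos]⟩
      apply gL_mem_slitPlane_of_im_pos
      have h1 := sgn_pt (by rw [imS]; exact hy0) (hcl y hy' hy0)
      rw [imS] at h1
      have hy1 : y < 0 := lt_of_le_of_ne hy.2 hy0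
      nlinarith
  -- the six exact edge logarithms
  have I_top : ∫ x : ℝ in α..β, Φ f ((x : ℂ) + (h : ℂ) * I) =
      Complex.log (gU f ((β : ℂ) + (h : ℂ) * I)) - Complex.log (gU f ((α : ℂ) + (h : ℂ) * I)) := by
    rw [← integral_logDeriv_horizontal (g := gU f) h hW.lt.le
      (fun x hx ↦ analyticAt_gU hfd (fT x hx)) sT]
    refine intervalIntegral.integral_congr fun x hx ↦ ?_
    rw [uIcc_of_le hW.lt.le] at hx
    exact (gU_logDeriv hfd (fT x hx) (dT x hx)).symm
  have I_bot : ∫ x : ℝ in α..β, Φ f ((x : ℂ) + ((-h : ℝ) : ℂ) * I) =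
      Complex.log (gL f ((β : ℂ) + ((-h : ℝ) : ℂ) * I)) -
        Complex.log (gL f ((α : ℂ) + ((-h : ℝ) : ℂ) * I)) := by
    rw [← integral_logDeriv_horizontal (g := gL f) (-h) hW.lt.le
      (fun x hx ↦ analyticAt_gL hfd (fB x hx)) sB]
    refine intervalIntegral.integral_congr fun x hx ↦ ?_
    rw [uIcc_of_le hW.lt.le] at hx
    exact (gL_logDeriv hfd (fB x hx) (dB x hx)).symm
  have I_vertU : ∀ {a : ℝ}, f a ≠ 0 → deriv f a ≠ 0 →
      (∀ y ∈ Icc (-h) h, y ≠ 0 → P ((a : ℂ) + (y : ℂ) * I)) →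
      I * ∫ y : ℝ in (0 : ℝ)..h, Φ f ((a : ℂ) + (y : ℂ) * I) =
        Complex.log (gU f ((a : ℂ) + (h : ℂ) * I)) - Complex.log (gU f ((a : ℂ) + ((0 : ℝ) : ℂ) * I)) := by
    intro a ha hda hcl
    have fa : ∀ y ∈ Icc (0 : ℝ) h, f ((a : ℂ) + (y : ℂ) * I) ≠ 0 :=
      fun y hy ↦ fS ha hcl y ⟨by linarith [hy.1, hW.pos], hy.2⟩
    have da : ∀ y ∈ Icc (0 : ℝ) h, deriv f ((a : ℂ) + (y : ℂ) * I) ≠ 0 :=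
      fun y hy ↦ dS hda hcl y ⟨by linarith [hy.1, hW.pos], hy.2⟩
    rw [← integral_logDeriv_vertical (g := gU f) a hW.pos.le
      (fun y hy ↦ analyticAt_gU hfd (fa y hy)) (sU ha hda hcl)]
    congr 1
    refine intervalIntegral.integral_congr fun y hy ↦ ?_
    rw [uIcc_of_le hW.pos.le] at hy
    exact (gU_logDeriv hfd (fa y hy) (da y hy)).symm
  have I_vertL : ∀ {a : ℝ}, f a ≠ 0 → deriv f a ≠ 0 →
      (∀ y ∈ Icc (-h) h, y ≠ 0 → P ((a : ℂ) + (y : ℂ) * I)) →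
      I * ∫ y : ℝ in (-h)..(0 : ℝ), Φ f ((a : ℂ) + (y : ℂ) * I) =
        Complex.log (gL f ((a : ℂ) + ((0 : ℝ) : ℂ) * I)) -
          Complex.log (gL f ((a : ℂ) + ((-h : ℝ) : ℂ) * I)) := by
    intro a ha hda hcl
    have hle : -h ≤ (0 : ℝ) := by linarith [hW.pos]
    have fa : ∀ y ∈ Icc (-h) (0 : ℝ), f ((a : ℂ) + (y : ℂ) * I) ≠ 0 :=
      fun y hy ↦ fS ha hcl y ⟨hy.1, by linarith [hy.2, hW.pos]⟩
    have da : ∀ y ∈ Icc (-h) (0 : ℝ), deriv f ((a : ℂ) + (y : ℂ) * I) ≠ 0 :=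
      fun y hy ↦ dS hda hcl y ⟨hy.1, by linarith [hy.2, hW.pos]⟩
    rw [← integral_logDeriv_vertical (g := gL f) a hle
      (fun y hy ↦ analyticAt_gL hfd (fa y hy)) (sLo ha hda hcl)]
    congr 1
    refine intervalIntegral.integral_congr fun y hy ↦ ?_
    rw [uIcc_of_le hle] at hy
    exact (gL_logDeriv hfd (fa y hy) (da y hy)).symm
  -- interval integrability on the half vertical edges
  have intU : ∀ {a : ℝ}, f a ≠ 0 → deriv f a ≠ 0 →
      (∀ y ∈ Icc (-h) h, y ≠ 0 → P ((a : ℂ) + (y : ℂ) * I)) →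
      IntervalIntegrable (fun y : ℝ ↦ Φ f ((a : ℂ) + (y : ℂ) * I)) MeasureTheory.volume (0 : ℝ) h :=
    fun ha hda hcl ↦ intervalIntegrable_of_continuousAt_vertical _ hW.pos.le
      (fun y hy ↦ continuousAt_Φ hfd (fS ha hcl y ⟨by linarith [hy.1, hW.pos], hy.2⟩)
        (dS hda hcl y ⟨by linarith [hy.1, hW.pos], hy.2⟩))
  have intL : ∀ {a : ℝ}, f a ≠ 0 → deriv f a ≠ 0 →
      (∀ y ∈ Icc (-h) h, y ≠ 0 → P ((a : ℂ) + (y : ℂ) * I)) →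
      IntervalIntegrable (fun y : ℝ ↦ Φ f ((a : ℂ) + (y : ℂ) * I)) MeasureTheory.volume (-h) (0 : ℝ) :=
    fun ha hda hcl ↦ intervalIntegrable_of_continuousAt_vertical _ (by linarith [hW.pos])
      (fun y hy ↦ continuousAt_Φ hfd (fS ha hcl y ⟨hy.1, by linarith [hy.2, hW.pos]⟩)
        (dS hda hcl y ⟨hy.1, by linarith [hy.2, hW.pos]⟩))
  -- evaluation of the boundary integral of `Φ` by logarithms
  have reβ : (deriv f β / f β).re ≠ 0 := fun h0 ↦
    (div_ne_zero hW.dβ hW.fβ) (Complex.ext h0 (logDeriv_ofReal_im' hfd hreal β))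
  have reα : (deriv f α / f α).re ≠ 0 := fun h0 ↦
    (div_ne_zero hW.dα hW.fα) (Complex.ext h0 (logDeriv_ofReal_im' hfd hreal α))
  have D : ∀ {a : ℝ}, (deriv f a / f a).re ≠ 0 →
      Complex.log (gL f ((a : ℂ) + ((0 : ℝ) : ℂ) * I)) - Complex.log (gU f ((a : ℂ) + ((0 : ℝ) : ℂ) * I)) =
        -(Real.pi * I) * sgn (deriv f a / f a).re := by
    intro a hre
    have e0 : ((a : ℂ) + ((0 : ℝ) : ℂ) * I) = (a : ℂ) := by simp
    have ea : deriv f a / f a = (((deriv f a / f a).re : ℝ) : ℂ) := by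
      apply Complex.ext
      · simp
      · simp [logDeriv_ofReal_im' hfd hreal a]
    rw [e0]
    simp only [gL, gU]
    conv_lhs => rw [ea]
    exact log_negI_mul_sub_log_I_mul hre
  have key : rectBoundaryIntegral (Φ f) α β (-h) h =
      Real.pi * I * (sgn (deriv f α / f α).re - sgn (deriv f β / f β).re) := by
    rw [rectBoundaryIntegral_def,
      ← intervalIntegral.integral_add_adjacent_intervals (intL hW.fβ hW.dβ hW.right)
        (intU hW.fβ hW.dβ hW.right),
      ← intervalIntegral.integral_add_adjacent_intervals (intL hW.fα hW.dα hW.left)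
        (intU hW.fα hW.dα hW.left),
      mul_add, mul_add, I_top, I_bot, I_vertU hW.fβ hW.dβ hW.right, I_vertL hW.fβ hW.dβ hW.right,
      I_vertU hW.fα hW.dα hW.left, I_vertL hW.fα hW.dα hW.left]
    have e : ∀ (LLb LLa LUb LUa L0Lb L0Ub L0La L0Ua : ℂ),
        LLb - LLa - (LUb - LUa) + (L0Lb - LLb + (LUb - L0Ub)) - (L0La - LLa + (LUa - L0Ua)) =
          (L0Lb - L0Ub) - (L0La - L0Ua) := by intros; ring
    rw [e, D reβ, D reα]
    ring
  -- evaluation by the argument principle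
  have hK : AnalyticOnNhd ℂ f (Icc α β ×ℂ Icc (-h) h) := fun z _ ↦ hfd.analyticAt z
  have hK' : AnalyticOnNhd ℂ (deriv f) (Icc α β ×ℂ Icc (-h) h) :=
    fun z _ ↦ (differentiable_deriv hfd).analyticAt z
  have AP_f : rectBoundaryIntegral (fun z ↦ deriv f z / f z) α β (-h) h =
      2 * Real.pi * I * zeroCountC f (Ioo α β ×ℂ Ioo (-h) h) := by
    rw [rectBoundaryIntegral_def, zeroCountC]
    exact integral_boundary_rect_logDeriv hW.lt hhl hK fB fT fL fR
  have AP_d : rectBoundaryIntegral (fun z ↦ deriv (deriv f) z / deriv f z) α β (-h) h =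
      2 * Real.pi * I * zeroCountC (deriv f) (Ioo α β ×ℂ Ioo (-h) h) := by
    rw [rectBoundaryIntegral_def, zeroCountC]
    exact integral_boundary_rect_logDeriv hW.lt hhl hK' dB dT dL dR
  have h1d := differentiable_deriv hfd
  have h2d := differentiable_deriv h1d
  have cA : ∀ {z : ℂ}, deriv f z ≠ 0 → ContinuousAt (fun z ↦ deriv (deriv f) z / deriv f z) z :=
    fun hz ↦ (h2d.continuous.continuousAt).div (h1d.continuous.continuousAt) hz
  have cB : ∀ {z : ℂ}, f z ≠ 0 → ContinuousAt (fun z ↦ (-1) * (deriv f z / f z)) z :=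
    fun hz ↦ continuousAt_const.mul ((h1d.continuous.continuousAt).div (hfd.continuous.continuousAt) hz)
  have split : rectBoundaryIntegral (Φ f) α β (-h) h =
      rectBoundaryIntegral (fun z ↦ deriv (deriv f) z / deriv f z) α β (-h) h -
        rectBoundaryIntegral (fun z ↦ deriv f z / f z) α β (-h) h := by
    have e : Φ f = fun z ↦ deriv (deriv f) z / deriv f z + (-1) * (deriv f z / f z) := by
      funext z; simp only [Φ]; ring
    rw [e, rectBoundaryIntegral_add hW.lt.le hhl.le
      (fun x hx ↦ cA (dB x hx)) (fun x hx ↦ cA (dT x hx)) (fun y hy ↦ cA (dL y hy))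
      (fun y hy ↦ cA (dR y hy))
      (fun x hx ↦ cB (fB x hx)) (fun x hx ↦ cB (fT x hx)) (fun y hy ↦ cB (fL y hy))
      (fun y hy ↦ cB (fR y hy)),
      rectBoundaryIntegral_const_mul]
    ring
  have main : Real.pi * I * (sgn (deriv f α / f α).re - sgn (deriv f β / f β).re) =
      2 * Real.pi * I * zeroCountC (deriv f) (Ioo α β ×ℂ Ioo (-h) h) -
        2 * Real.pi * I * zeroCountC f (Ioo α β ×ℂ Ioo (-h) h) := by
    rw [← key, split, AP_d, AP_f]
  have hπ : (Real.pi : ℂ) * I ≠ 0 := mul_ne_zero (by exact_mod_cast Real.pi_ne_zero) I_ne_zero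
  refine mul_left_cancel₀ hπ ?_
  linear_combination (-1 : ℂ) * main


/-- **THE JENSEN-WINDOW CENSUS** (real entire `f` of order `< 2` with a zero; Jensen window). [cite: Kim1996, (2.4) pp. 822–823] -/
theorem census (hf : RealEntireLt2 f) {α β h : ℝ} (hW : Window f α β h) (hex : ∃ a, f a = 0) :
    2 * (zeroCountC (deriv f) (Ioo α β ×ℂ Ioo (-h) h) - zeroCountC f (Ioo α β ×ℂ Ioo (-h) h)) =
      sgn (deriv f α / f α).re - sgn (deriv f β / f β).re := by
  obtain ⟨ρ, C, hρ0, hρ, hgr⟩ := hf.growth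
  exact census_core hf.diff hf.real
    (fun hw hc ↦ im_mul_im_logDeriv_neg hf.diff hρ0 hρ hgr hf.real hex hw hc) hW.toSWindow

/-! ## 3. Consequence: no non-real zeros when the real-axis Rolle identity holds -/

/-- Helper `order_pos` (see the module docstring). -/
theorem order_pos (hfd : Differentiable ℂ f) {P : ℂ → Prop} {α β h : ℝ} (hW : SWindow f P α β h)
    {z : ℂ} (hz : z ∈ Ioo α β ×ℂ Ioo (-h) h) (h0 : f z = 0) :
    0 < (meromorphicOrderAt f z).untop₀ := by
  have hK : AnalyticOnNhd ℂ f (Icc α β ×ℂ Icc (-h) h) := fun z _ ↦ hfd.analyticAt z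
  have hαmem : ((α : ℝ) : ℂ) ∈ Icc α β ×ℂ Icc (-h) h :=
    ⟨by simpa using hW.lt.le, by simp [hW.pos.le]⟩
  have hzK : z ∈ Icc α β ×ℂ Icc (-h) h := ⟨Ioo_subset_Icc_self hz.1, Ioo_subset_Icc_self hz.2⟩
  have han : AnalyticAt ℂ f z := hfd.analyticAt z
  have hne := analyticOrderAt_ne_top_of_reProdIm hW.lt.le (by linarith [hW.pos]) hK hαmem hW.fα hzK
  rw [han.meromorphicOrderAt_eq]
  cases hq : analyticOrderAt f z with
  | top => exact absurd hq hne
  | coe n =>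
    have hn : n ≠ 0 := by
      intro hn0
      rw [hn0] at hq
      exact ((han.analyticOrderAt_eq_zero).mp (by exact_mod_cast hq)) h0
    have : 0 < n := Nat.pos_of_ne_zero hn
    simpa using this

/-- The **real Rolle identity** on `[α,β]` (what the local Laguerre sign law B forces):
`2 (N^ℝ_{f'}(α,β) − N^ℝ_f(α,β)) = sgn ψ(α) − sgn ψ(β)`, real zeros with multiplicity. -/
def RolleIdentity (f : ℂ → ℂ) (α β h : ℝ) : Prop :=
  2 * (zeroCountC (deriv f) ((Ioo α β ×ℂ Ioo (-h) h) ∩ {ρ | ρ.im = 0}) -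
      zeroCountC f ((Ioo α β ×ℂ Ioo (-h) h) ∩ {ρ | ρ.im = 0})) =
    sgn (deriv f α / f α).re - sgn (deriv f β / f β).re

/-- Local A: the zeros of `f'` in the open window are real. -/
def LocalA (f : ℂ → ℂ) (α β h : ℝ) : Prop :=
  ∀ ρ ∈ Ioo α β ×ℂ Ioo (-h) h, deriv f ρ = 0 → ρ.im = 0

/-- Local B (Laguerre sign law at the real critical points in `(α,β)` off the zeros of `f`). -/
def LocalB (f : ℂ → ℂ) (α β : ℝ) : Prop :=
  ∀ x : ℝ, x ∈ Ioo α β → deriv f x = 0 → f x ≠ 0 → (f x * deriv (deriv f) x).re < 0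

/-- (Core form.) No non-real zeros in a sign window from local A and the real Rolle identity. -/
theorem no_nonreal_zero_of_rolle_core (hfd : Differentiable ℂ f) (hreal : ∀ x : ℝ, (f x).im = 0)
    {P : ℂ → Prop} (hsgn : ∀ {w : ℂ}, w.im ≠ 0 → P w → w.im * (deriv f w / f w).im < 0)
    {α β h : ℝ} (hW : SWindow f P α β h)
    (hA : LocalA f α β h) (hR : RolleIdentity f α β h) :
    ∀ ρ ∈ Ioo α β ×ℂ Ioo (-h) h, f ρ = 0 → ρ.im = 0 := by
  classical
  have hc := census_core hfd hreal hsgn hW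
  set K : Set ℂ := Ioo α β ×ℂ Ioo (-h) h with hKdef
  have hKc : AnalyticOnNhd ℂ f (Icc α β ×ℂ Icc (-h) h) := fun z _ ↦ hfd.analyticAt z
  have hαmem : ((α : ℝ) : ℂ) ∈ Icc α β ×ℂ Icc (-h) h :=
    ⟨by simpa using hW.lt.le, by simp [hW.pos.le]⟩
  have hfin : {ρ : ℂ | f ρ = 0 ∧ ρ ∈ K}.Finite :=
    finite_zeros_reProdIm hW.lt.le (by linarith [hW.pos]) hKc hαmem hW.fα
  have e1 : {ρ : ℂ | deriv f ρ = 0 ∧ ρ ∈ K} = {ρ : ℂ | deriv f ρ = 0 ∧ ρ ∈ K ∩ {ρ | ρ.im = 0}} := by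
    ext ρ
    simp only [mem_setOf_eq, mem_inter_iff]
    constructor
    · rintro ⟨h0, hK⟩; exact ⟨h0, hK, hA ρ hK h0⟩
    · rintro ⟨h0, hK, -⟩; exact ⟨h0, hK⟩
  have e1' : zeroCountC (deriv f) K = zeroCountC (deriv f) (K ∩ {ρ | ρ.im = 0}) := by
    unfold zeroCountC; rw [e1]
  set B : Set ℂ := {ρ : ℂ | f ρ = 0 ∧ ρ ∈ K ∧ ρ.im ≠ 0} with hBdef
  have e2 : {ρ : ℂ | f ρ = 0 ∧ ρ ∈ K} = {ρ : ℂ | f ρ = 0 ∧ ρ ∈ K ∩ {ρ | ρ.im = 0}} ∪ B := by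
    ext ρ
    simp only [mem_setOf_eq, mem_inter_iff, mem_union, hBdef]
    constructor
    · rintro ⟨h0, hK⟩
      by_cases him : ρ.im = 0
      · exact Or.inl ⟨h0, hK, him⟩
      · exact Or.inr ⟨h0, hK, him⟩
    · rintro (⟨h0, hK, -⟩ | ⟨h0, hK, -⟩) <;> exact ⟨h0, hK⟩
  have hdisj : Disjoint {ρ : ℂ | f ρ = 0 ∧ ρ ∈ K ∩ {ρ | ρ.im = 0}} B := by
    rw [Set.disjoint_left]
    rintro ρ ⟨-, -, him⟩ ⟨-, -, him'⟩
    exact him' him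
  have hAfin : {ρ : ℂ | f ρ = 0 ∧ ρ ∈ K ∩ {ρ | ρ.im = 0}}.Finite :=
    hfin.subset fun ρ hρ ↦ ⟨hρ.1, hρ.2.1⟩
  have hBfin : B.Finite := hfin.subset fun ρ hρ ↦ ⟨hρ.1, hρ.2.1⟩
  have e2' : zeroCountC f K = zeroCountC f (K ∩ {ρ | ρ.im = 0}) +
      ∑ᶠ ρ ∈ B, ((meromorphicOrderAt f ρ).untop₀ : ℂ) := by
    unfold zeroCountC; rw [e2, finsum_mem_union hdisj hAfin hBfin]
  have hB0 : ∑ᶠ ρ ∈ B, ((meromorphicOrderAt f ρ).untop₀ : ℂ) = 0 := by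
    rw [e1', e2'] at hc
    unfold RolleIdentity at hR
    linear_combination (1 / 2 : ℂ) * hR - (1 / 2 : ℂ) * hc
  rw [finsum_mem_eq_finite_toFinset_sum _ hBfin, ← Int.cast_sum] at hB0
  have hB0' : ∑ ρ ∈ hBfin.toFinset, (meromorphicOrderAt f ρ).untop₀ = 0 := by exact_mod_cast hB0
  have hpos : ∀ ρ ∈ hBfin.toFinset, 0 < (meromorphicOrderAt f ρ).untop₀ := by
    intro ρ hρ
    rw [Set.Finite.mem_toFinset] at hρ
    exact order_pos hfd hW hρ.2.1 hρ.1
  have hall := (Finset.sum_eq_zero_iff_of_nonneg fun ρ hρ ↦ (hpos ρ hρ).le).mp hB0'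
  intro ρ hρK hρ0
  by_contra him
  have hρB : ρ ∈ hBfin.toFinset := by
    rw [Set.Finite.mem_toFinset]; exact ⟨hρ0, hρK, him⟩
  have := hall ρ hρB
  have := hpos ρ hρB
  omega

/-- **No non-real zeros in a Jensen window** from local A and the real Rolle identity. -/
theorem no_nonreal_zero_of_rolle (hf : RealEntireLt2 f) {α β h : ℝ} (hW : Window f α β h)
    (hA : LocalA f α β h) (hR : RolleIdentity f α β h) :
    ∀ ρ ∈ Ioo α β ×ℂ Ioo (-h) h, f ρ = 0 → ρ.im = 0 := by
  by_cases hex : ∃ a, f a = 0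
  swap
  · intro ρ _ hρ; exact absurd ⟨ρ, hρ⟩ hex
  obtain ⟨ρ, C, hρ0, hρ, hgr⟩ := hf.growth
  exact no_nonreal_zero_of_rolle_core hf.diff hf.real
    (fun hw hc ↦ im_mul_im_logDeriv_neg hf.diff hρ0 hρ hgr hf.real hex hw hc) hW.toSWindow hA hR


end Summit.RiemannHypothesis.RiemannHypothesis.Theorems.Splittings.JensenWindow
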